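import Summits.QuantumAdvantage.QuantumAdvantage.Theorems.ParityDialE
import HarnessLib

/-!
# PeriodDial — decomp-qadv lens-2 g30 «structural dichotomy», node beneath the GENERIC LEAF `ParityDial.PGlobalFail 2 2 7`

THE PERIOD DIAL.  ParityDial split the even-length light game at weight 7 into parity-local strategies (period 2; CLOSED by universal inputs)
and the generic rest `PGlobalFail 2 2 7` (OPEN, law-bet).  This node turns the period into a DIAL `m = 2, 4, 8, …`: a strategy is
`m`-PERIODIC-LOCAL of radius `r` (`IsPeriodicLocal m r`) when two positions in the same class mod `m` with the same radius-`r` window always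
answer alike (ANY input-global advice allowed, no degree hypothesis).  Period 2 = parity-local (`isPeriodicLocal_two_iff`); `m ∣ m'` ⇒
`m`-periodic ⊆ `m'`-periodic (`IsPeriodicLocal.of_dvd`); period `≥ n` = every strategy (`isPeriodicLocal_of_le`).  By residue of the length,
`PGlobalFail 2 2 7 ⟺ PGlobalFailRes 0 2 2 7 ∧ PGlobalFailRes 2 2 2 7` (`pGlobalFail_iff_res`), and on `n ≡ 0 (mod 4)` the leaf splits EXACTLY
along the dial: `PGlobalFailRes 0 2 2 7 ⟺ AperiodicFailRes 0 4 2 2 7` (`pGlobalFailRes_zero_iff_aperiodic`), because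

★★ SPECIAL `PeriodicFailRes 0 4 2 7` IS A THEOREM (`periodicFailRes_zero_four_two_seven`, §5; degree-free): eventually in `n ≡ 0 (mod 4)` every
   4-periodic-local radius-2 strategy loses on an odd-class input of weight ≤ 7 — two explicit weight-7 PERIOD-4-UNIVERSAL-HARD families (§4,
   `n ≡ 0 / 4 (mod 8)`, far blocks `t ↦ t ± 4`), engine `periodicUniversalHard_of_pairing` (§1); exactness `periodicFailRes_iff_universal` (§3):
   the special piece IS the eventual existence of light universal inputs.
•  GENERIC `AperiodicFailRes 0 4 2 2 7` (OPEN): eventually in `n ≡ 0 (mod 4)` every degree-≤2 strategy that is NOT 4-periodic-local loses at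
   weight ≤ 7 — WEAKER than the leaf-residue (`aperiodicFailRes_of_res`: the strategies whose same-window disagreements sit only at offsets
   `≡ 2 (mod 4)` are carved out, and they are killed by the theorem); the dial continues (`aperiodicFailRes_mono`, `m ∣ m'`).
★  THE SEAM (§6): on `n ≡ 2 (mod 4)` the period-4 special piece is FALSE for every radius and weight (`not_periodicFailRes_two_four`): with the
   labelling `b ↦ b mod 4` the classes do not close up, summing the kernel relation over a class forces a kernel vector with all radius-0 types
   even to vanish across the seam (`seam_zero`), so NO period-4-universal input exists (`not_periodicUniversalHard_four`) and, by exactness,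
   PERFECT 4-periodic-local strategies (of uncontrolled degree) exist at every large `n ≡ 2 (mod 4)`.  There parity is the top of the periodic
   dial (`periodicFailRes_two_dichotomy`); the residue `PGlobalFailRes 2 2 2 7` (OPEN) needs a non-periodic idea.
NODE: `PGlobalFail 2 2 7 ⟺ AperiodicFailRes 0 4 2 2 7 ∧ PGlobalFailRes 2 2 2 7` (`leaf_iff_pieces`); kernel `closes : AperiodicFailRes 0 4 2 2 7 →
PGlobalFailRes 2 2 2 7 → OGlobalFail 2 2 7 → NoPerfectTwo3` BY NAME via `ParityDial.closes₃`.
Numerics (HOME/decomp-qadv-lens-2/g30/num): degree-free perfect-to-5 period-4 radius-1 rule tables form an affine space of dim 58 vs 30 for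
period 2 (`linperf.py`, n = 16..24: the carved-out class is far from empty at weight 5); in the basic quadratic-realisable family (3⁹ options per
class) every perfect-to-5 period-4 rule at n = 16 is already period 2 (`p4mix.py`); families re-verified (`famcheck.py`); seam data (`inv4*.log`).
§1 definitions + engine · §2 dial algebra · §3 pieces, split, exactness · §4 families P0/P4 · §5 the theorem, exactness of the node, kernel ·
§6 the seam.  All proofs complete; standard axioms only (audit at the end).  Not in print.
-/

set_option linter.dupNamespace false
set_option linter.style.longLine false

noncomputable section
open scoped Classical

namespace Summit.QuantumAdvantage.QuantumAdvantage.Theorems.PeriodDial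
open Finset
open Literature.Computability.QuantumComplexity Literature.Computability.QuantumComplexity.RingHLF
open Literature.Computability.MetaComplexity Literature.Computability.MetaComplexity.Smolensky
open Summit.QuantumAdvantage.AdviceFreeQNC0 (OddZeros kernel_odd)
open Summit.QuantumAdvantage.AdviceFreeQNC0.Fib19 (IsOdd isOdd_iff_oddZeros kline kline_inKernel kline_hardCore)
open Summit.QuantumAdvantage.AdviceFreeQNC0.LightConeWindowHard
  (window window_apply dot2_eq_zero_of_pairing nxt_val prv_val xor3_eq_false_iff)
open Summit.QuantumAdvantage.QuantumAdvantage.Theorems.LightDial (wt wt_le_of_val_mem lightLosing LightFail)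
open Summit.QuantumAdvantage.QuantumAdvantage.Theorems.ParityDial
  (par IsParityLocal PLocalFail PGlobalFail OGlobalFail ParityUniversalHard closes₃ pLocalFail_two_seven window_eq_of_le window_centre
   parityUniversalHard_two_all not_rel_of_isParityLocal)
open Summit.QuantumAdvantage.QuantumAdvantage.Theses.ExactnessDial (NoPerfectTwo3)

variable {n : ℕ}

/-! ## §1 Periodic-local strategies, periodic-universal-hard inputs, the pairing engine -/

/-- the class of a position modulo `m` (labelling `b ↦ b mod m` of `[0, n)`; a rotation-invariant structure iff `m ∣ n`). -/
def cls (m : ℕ) (i : Fin n) : ℕ := (i : ℕ) % m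

/-- a strategy is `m`-PERIODIC-LOCAL of radius `r`: on every input, two positions in the same class mod `m` with the same radius-`r` window
answer alike — `z_i = F(i mod m, x|[i−r,i+r], a(x))` for a rule table `F` and an arbitrary input-global advice `a` (no degree hypothesis). -/
def IsPeriodicLocal (m r : ℕ) (P : Fin n → CubeFn (ZMod 3) n) : Prop :=
  ∀ x : Fin n → Bool, ∀ i j : Fin n, cls m i = cls m j → window r x i = window r x j → (P i x = 1 ↔ P j x = 1)

/-- the periodic-local strategy with rule table `F`: `z_i = F (i mod m) (x|[i−r, i+r])`. -/
def perStrat (m r : ℕ) (F : ℕ → (Fin (2 * r + 1) → Bool) → Bool) (x : Fin n → Bool) : Fin n → Bool :=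
  fun i => F (cls m i) (window r x i)

/-- `x` is PERIOD-`m`-UNIVERSAL-HARD at radius `r`: odd class, and EVERY `m`-periodic rule table of radius `r` violates the ring relation on it. -/
def PeriodicUniversalHard (m r : ℕ) (x : Fin n → Bool) : Prop :=
  OddZeros x ∧ ∀ F : ℕ → (Fin (2 * r + 1) → Bool) → Bool, ¬ Rel x (perStrat m r F x)

/-- ENGINE: a kernel vector with sign bit `1` whose support carries a fixed-point-free involution preserving window AND class mod `m` defeats
every `m`-periodic rule table. -/
theorem not_rel_per_of_pairing (m r : ℕ) (x v : Fin n → Bool) (σ : Fin n → Fin n)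
    (hK : InKernel x v) (hsign : signBit x v = 1)
    (hσv : ∀ b, v b = true → v (σ b) = true) (hσw : ∀ b, v b = true → window r x (σ b) = window r x b)
    (hσc : ∀ b, v b = true → cls m (σ b) = cls m b)
    (hfix : ∀ b, v b = true → σ b ≠ b) (hinv : ∀ b, v b = true → σ (σ b) = b)
    (F : ℕ → (Fin (2 * r + 1) → Bool) → Bool) : ¬ Rel x (perStrat m r F x) := by
  intro h
  have h1 := h v hK
  rw [dot2_eq_zero_of_pairing v _ σ hσv (fun b hb => by simp only [perStrat, hσw b hb, hσc b hb]) hfix hinv, hsign] at h1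
  exact absurd h1 (by decide)

/-- `PeriodicUniversalHard` from a pairing certificate. -/
theorem periodicUniversalHard_of_pairing (m r : ℕ) (x v : Fin n → Bool) (σ : Fin n → Fin n)
    (hodd : OddZeros x) (hK : InKernel x v) (hsign : signBit x v = 1)
    (hσv : ∀ b, v b = true → v (σ b) = true) (hσw : ∀ b, v b = true → window r x (σ b) = window r x b)
    (hσc : ∀ b, v b = true → cls m (σ b) = cls m b)
    (hfix : ∀ b, v b = true → σ b ≠ b) (hinv : ∀ b, v b = true → σ (σ b) = b) : PeriodicUniversalHard m r x :=
  ⟨hodd, fun F => not_rel_per_of_pairing m r x v σ hK hsign hσv hσw hσc hfix hinv F⟩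

/-- ANY ADVICE: a period-`m`-universal-hard input defeats every `m`-periodic rule with every input-global advice of every type. -/
theorem periodicUniversalHard_any_advice {m r : ℕ} {x : Fin n → Bool} (h : PeriodicUniversalHard m r x) {α : Type*}
    (adv : (Fin n → Bool) → α) (F : ℕ → (Fin (2 * r + 1) → Bool) → α → Bool) :
    ¬ Rel x (fun i => F (cls m i) (window r x i) (adv x)) :=
  h.2 (fun c w => F c w (adv x))

/-- a periodic-local strategy factors through `perStrat` on each input, so a period-universal-hard input defeats it. -/
theorem not_rel_of_isPeriodicLocal {m r : ℕ} {P : Fin n → CubeFn (ZMod 3) n} (hP : IsPeriodicLocal m r P) {x : Fin n → Bool}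
    (hx : PeriodicUniversalHard m r x) : ¬ Rel x (fun i => decide (P i x = 1)) := by
  have key : (fun i => decide (P i x = 1)) = perStrat m r (fun c w =>
      if h : ∃ j : Fin n, cls m j = c ∧ window r x j = w then decide (P h.choose x = 1) else false) x := by
    funext i
    have h : ∃ j : Fin n, cls m j = cls m i ∧ window r x j = window r x i := ⟨i, rfl, rfl⟩
    simp only [perStrat, dif_pos h]
    obtain ⟨hc, hw⟩ := h.choose_spec
    rw [decide_eq_decide]
    exact (hP x _ _ hc hw).symm
  rw [key]
  exact hx.2 _

/-- period-universal-hard refines parity-universal-hard when `2 ∣ m` (a parity rule is an `m`-periodic rule). -/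
theorem parityUniversalHard_of_periodic {m r : ℕ} (hm : 2 ∣ m) {x : Fin n → Bool} (h : PeriodicUniversalHard m r x) :
    ParityUniversalHard r x := by
  refine ⟨h.1, fun F hrel => h.2 (fun c w => F (decide (c % 2 = 0)) w) ?_⟩
  have e : perStrat m r (fun c w => F (decide (c % 2 = 0)) w) x = ParityDial.plocStrat r F x := by
    funext i
    simp only [perStrat, ParityDial.plocStrat, par, cls, Nat.mod_mod_of_dvd _ hm]
  rw [e]; exact hrel

/-! ## §2 Dial algebra: period 2 = parity; `m ∣ m'`; period `≥ n` = everything; radius -/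

/-- PERIOD 2 IS PARITY: `IsPeriodicLocal 2 r P ↔ IsParityLocal r P`. -/
theorem isPeriodicLocal_two_iff {r : ℕ} (P : Fin n → CubeFn (ZMod 3) n) : IsPeriodicLocal 2 r P ↔ IsParityLocal r P := by
  have hc : ∀ i j : Fin n, cls 2 i = cls 2 j ↔ par i = par j := fun i j => by
    simp only [cls, par, decide_eq_decide]; omega
  exact ⟨fun h x i j hp hw => h x i j ((hc i j).mpr hp) hw, fun h x i j hp hw => h x i j ((hc i j).mp hp) hw⟩

/-- THE DIAL IS MONOTONE: an `m`-periodic-local strategy is `m'`-periodic-local for every multiple `m'` of `m`. -/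
theorem IsPeriodicLocal.of_dvd {m m' r : ℕ} (h : m ∣ m') {P : Fin n → CubeFn (ZMod 3) n} (hP : IsPeriodicLocal m r P) :
    IsPeriodicLocal m' r P := fun x i j hc hw => hP x i j (by
  simp only [cls] at hc ⊢
  rw [← Nat.mod_mod_of_dvd (i : ℕ) h, ← Nat.mod_mod_of_dvd (j : ℕ) h, hc]) hw

/-- parity-local ⇒ `m`-periodic-local for every even `m`. -/
theorem isPeriodicLocal_of_isParityLocal {m r : ℕ} (hm : 2 ∣ m) {P : Fin n → CubeFn (ZMod 3) n} (hP : IsParityLocal r P) :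
    IsPeriodicLocal m r P := ((isPeriodicLocal_two_iff P).mpr hP).of_dvd hm

/-- TOP OF THE DIAL: once the period reaches the length, EVERY strategy is periodic-local (classes are singletons). -/
theorem isPeriodicLocal_of_le {m r : ℕ} (h : n ≤ m) (P : Fin n → CubeFn (ZMod 3) n) : IsPeriodicLocal m r P := by
  intro x i j hc _
  have hi := i.isLt; have hj := j.isLt
  simp only [cls, Nat.mod_eq_of_lt (show (i : ℕ) < m by omega), Nat.mod_eq_of_lt (show (j : ℕ) < m by omega)] at hc
  rw [Fin.ext hc]

/-- RADIUS MONOTONICITY: `m`-periodic-local of radius `r` ⇒ of radius `r' ≥ r` (`r' ≤ n`). -/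
theorem IsPeriodicLocal.mono_radius {m r r' : ℕ} (h : r ≤ r') (hn : r' ≤ n) {P : Fin n → CubeFn (ZMod 3) n}
    (hP : IsPeriodicLocal m r P) : IsPeriodicLocal m r' P :=
  fun x i j hc hw => hP x i j hc (window_eq_of_le h hn x hw)

/-- conversely universal hardness descends along `m ∣ m'` (an `m`-rule is an `m'`-rule). -/
theorem PeriodicUniversalHard.of_dvd {m m' r : ℕ} (h : m ∣ m') {x : Fin n → Bool} (hx : PeriodicUniversalHard m' r x) :
    PeriodicUniversalHard m r x := by
  refine ⟨hx.1, fun F hrel => hx.2 (fun c w => F (c % m) w) ?_⟩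
  have e : perStrat m' r (fun c w => F (c % m) w) x = perStrat m r F x := by
    funext i; simp only [perStrat, cls, Nat.mod_mod_of_dvd _ h]
  rw [e]; exact hrel

/-! ## §3 The pieces by residue `a` of the length mod 4: leaf-residue `PGlobalFailRes a`; special `PeriodicFailRes a m`; generic
`AperiodicFailRes a m`; the split; monotonicity; degree-free exactness -/

/-- the GENERIC LEAF restricted to the lengths `n ≡ a (mod 4)`: eventually in such `n`, every degree-`≤ D` strategy that is not parity-local of
radius `r` loses on an odd-class input of weight `≤ w` (`PGlobalFail r D w` is the case "all even `n`": `pGlobalFail_iff_res`). -/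
def PGlobalFailRes (a r D w : ℕ) : Prop :=
  ∃ n₀ : ℕ, ∀ n ≥ n₀, n % 4 = a → ∀ P : Fin n → CubeFn (ZMod 3) n, (∀ i, P i ∈ lowDeg (ZMod 3) n D) → ¬ IsParityLocal r P →
    ∃ x : Fin n → Bool, OddZeros x ∧ wt x ≤ w ∧ ¬ Rel x (fun i => decide (P i x = 1))

/-- EQUIV (bookkeeping): the leaf is the conjunction of its two residue classes mod 4. -/
theorem pGlobalFail_iff_res (r D w : ℕ) : PGlobalFail r D w ↔ PGlobalFailRes 0 r D w ∧ PGlobalFailRes 2 r D w := by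
  constructor
  · rintro ⟨n₀, h⟩
    exact ⟨⟨n₀, fun n hn ha => h n hn (by omega)⟩, ⟨n₀, fun n hn ha => h n hn (by omega)⟩⟩
  · rintro ⟨⟨n₀, h₀⟩, ⟨n₂, h₂⟩⟩
    refine ⟨n₀ + n₂, fun n hn he => ?_⟩
    rcases Nat.even_or_odd (n / 2) with ⟨k, hk⟩ | ⟨k, hk⟩
    · exact h₀ n (by omega) (by omega)
    · exact h₂ n (by omega) (by omega)

/-- SPECIAL PIECE `PeriodicFailRes a m r w` (degree-free): eventually in `n ≡ a (mod 4)`, every `m`-periodic-local strategy of radius `r`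
loses on an odd-class input of weight `≤ w`.  PROVED at `(0, 4, 2, 7)` (§5); FALSE at `a = 2`, `m = 4`, every `r, w` (§6, the seam). -/
def PeriodicFailRes (a m r w : ℕ) : Prop :=
  ∃ n₀ : ℕ, ∀ n ≥ n₀, n % 4 = a → ∀ P : Fin n → CubeFn (ZMod 3) n, IsPeriodicLocal m r P →
    ∃ x : Fin n → Bool, OddZeros x ∧ wt x ≤ w ∧ ¬ Rel x (fun i => decide (P i x = 1))

/-- GENERIC PIECE `AperiodicFailRes a m r D w`: eventually in `n ≡ a (mod 4)`, every degree-`≤ D` strategy that is NOT `m`-periodic-local of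
radius `r` loses on an odd-class input of weight `≤ w`.  OPEN at `(0, 4, 2, 2, 7)`; the hypothesis class shrinks as `m` grows. -/
def AperiodicFailRes (a m r D w : ℕ) : Prop :=
  ∃ n₀ : ℕ, ∀ n ≥ n₀, n % 4 = a → ∀ P : Fin n → CubeFn (ZMod 3) n, (∀ i, P i ∈ lowDeg (ZMod 3) n D) → ¬ IsPeriodicLocal m r P →
    ∃ x : Fin n → Bool, OddZeros x ∧ wt x ≤ w ∧ ¬ Rel x (fun i => decide (P i x = 1))

/-- ★ THE SPLIT: special (period `m`) + generic (not period `m`) ⇒ the leaf-residue (any `m`; for `2 ∣ m` the generic piece is moreover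
implied by the leaf-residue, `aperiodicFailRes_of_res`). -/
theorem pGlobalFailRes_of_period {a m r D w : ℕ} (hs : PeriodicFailRes a m r w) (hg : AperiodicFailRes a m r D w) :
    PGlobalFailRes a r D w := by
  obtain ⟨n₁, h₁⟩ := hs; obtain ⟨n₂, h₂⟩ := hg
  refine ⟨n₁ + n₂, fun n hn h4 P hP _ => ?_⟩
  by_cases hper : IsPeriodicLocal m r P
  · exact h₁ n (by omega) h4 P hper
  · exact h₂ n (by omega) h4 P hP hper

/-- the generic piece is WEAKER than the leaf-residue (certificate of «strictly fewer strategies»): for `2 ∣ m`,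
`PGlobalFailRes a r D w → AperiodicFailRes a m r D w`. -/
theorem aperiodicFailRes_of_res {a m r D w : ℕ} (hm : 2 ∣ m) (h : PGlobalFailRes a r D w) : AperiodicFailRes a m r D w := by
  obtain ⟨n₀, h₀⟩ := h
  exact ⟨n₀, fun n hn h4 P hP hnp => h₀ n hn h4 P hP fun hpl => hnp (isPeriodicLocal_of_isParityLocal hm hpl)⟩

/-- THE DIAL on the generic side: `m ∣ m'` ⇒ `AperiodicFailRes a m → AperiodicFailRes a m'` (fewer strategies remain). -/
theorem aperiodicFailRes_mono {a m m' r D w : ℕ} (h : m ∣ m') (hg : AperiodicFailRes a m r D w) : AperiodicFailRes a m' r D w := by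
  obtain ⟨n₀, h₀⟩ := hg
  exact ⟨n₀, fun n hn h4 P hP hnp => h₀ n hn h4 P hP fun hp => hnp (hp.of_dvd h)⟩

/-- … and on the special side: `m ∣ m'` ⇒ `PeriodicFailRes a m' → PeriodicFailRes a m` (more strategies are special). -/
theorem periodicFailRes_anti {a m m' r w : ℕ} (h : m ∣ m') (hs : PeriodicFailRes a m' r w) : PeriodicFailRes a m r w := by
  obtain ⟨n₀, h₀⟩ := hs
  exact ⟨n₀, fun n hn h4 P hp => h₀ n hn h4 P (hp.of_dvd h)⟩

/-- the special piece SHRINKS with the radius: `PeriodicFailRes a m r' w → PeriodicFailRes a m r w` for `r ≤ r'`. -/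
theorem periodicFailRes_anti_radius {a m r r' w : ℕ} (h : r ≤ r') (hs : PeriodicFailRes a m r' w) : PeriodicFailRes a m r w := by
  obtain ⟨n₀, h₀⟩ := hs
  exact ⟨n₀ + r', fun n hn h4 P hp => h₀ n (by omega) h4 P (hp.mono_radius h (by omega))⟩

/-- the generic piece SHRINKS with the radius too: `AperiodicFailRes a m r D w → AperiodicFailRes a m r' D w` for `r ≤ r'`. -/
theorem aperiodicFailRes_mono_radius {a m r r' D w : ℕ} (h : r ≤ r') (hg : AperiodicFailRes a m r D w) :
    AperiodicFailRes a m r' D w := by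
  obtain ⟨n₀, h₀⟩ := hg
  exact ⟨n₀ + r', fun n hn h4 P hP hnp => h₀ n (by omega) h4 P hP fun hp => hnp (hp.mono_radius h (by omega))⟩

/-- the generic piece GROWS with the degree bound: `AperiodicFailRes a m r D' w → AperiodicFailRes a m r D w` for `D ≤ D'`. -/
theorem aperiodicFailRes_anti_degree {a m r D D' w : ℕ} (h : D ≤ D') (hg : AperiodicFailRes a m r D' w) :
    AperiodicFailRes a m r D w := by
  obtain ⟨n₀, h₀⟩ := hg
  exact ⟨n₀, fun n hn h4 P hP hnp => h₀ n hn h4 P (fun i => lowDeg_mono h (hP i)) hnp⟩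

/-- LEVEL 2 OF THE DIAL IS THE OLD SPECIAL PIECE: `PeriodicFailRes a 2 2 7` for both even residues, from ParityDial's ★★ `pLocalFail_two_seven`. -/
theorem periodicFailRes_two_two_seven {a : ℕ} (ha : a % 2 = 0) : PeriodicFailRes a 2 2 7 := by
  obtain ⟨n₀, h₀⟩ := pLocalFail_two_seven
  exact ⟨n₀, fun n hn h4 P hp => h₀ n hn (by omega) P ((isPeriodicLocal_two_iff P).mp hp)⟩

/-- universal inputs give the special piece. -/
theorem periodicFailRes_of_universal {a m r w : ℕ}
    (h : ∃ n₀ : ℕ, ∀ n ≥ n₀, n % 4 = a → ∃ x : Fin n → Bool, wt x ≤ w ∧ PeriodicUniversalHard m r x) : PeriodicFailRes a m r w := by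
  obtain ⟨n₀, h₀⟩ := h
  refine ⟨n₀, fun n hn h4 P hP => ?_⟩
  obtain ⟨x, hw, hx⟩ := h₀ n hn h4
  exact ⟨x, hx.1, hw, not_rel_of_isPeriodicLocal hP hx⟩

/-- ★ DEGREE-FREE EXACTNESS of the special piece: `PeriodicFailRes a m r w` IS the eventual existence of a light period-`m`-universal-hard
input (if some length had none, choosing a winning table input by input defines a perfect `m`-periodic-local strategy there). -/
theorem periodicFailRes_iff_universal (a m r w : ℕ) :
    PeriodicFailRes a m r w ↔ ∃ n₀ : ℕ, ∀ n ≥ n₀, n % 4 = a → ∃ x : Fin n → Bool, wt x ≤ w ∧ PeriodicUniversalHard m r x := by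
  refine ⟨fun ⟨n₀, h₀⟩ => ⟨n₀, fun n hn h4 => ?_⟩, periodicFailRes_of_universal⟩
  by_contra hno
  have hno' : ∀ x : Fin n → Bool, wt x ≤ w → ¬ PeriodicUniversalHard m r x := fun x hw hp => hno ⟨x, hw, hp⟩
  -- for every light odd-class input pick a winning table (one exists since the input is not universal-hard)
  have hF : ∀ x : Fin n → Bool, ∃ F : ℕ → (Fin (2 * r + 1) → Bool) → Bool,
      (wt x ≤ w → OddZeros x → Rel x (perStrat m r F x)) := by
    intro x
    by_cases hx : wt x ≤ w ∧ OddZeros x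
    · have hnu := hno' x hx.1
      simp only [PeriodicUniversalHard, not_and, not_forall, not_not] at hnu
      obtain ⟨F, hF⟩ := hnu hx.2
      exact ⟨F, fun _ _ => hF⟩
    · exact ⟨fun _ _ => false, fun h1 h2 => absurd ⟨h1, h2⟩ hx⟩
  choose F hF using hF
  let P : Fin n → CubeFn (ZMod 3) n := fun i x => if perStrat m r (F x) x i = true then 1 else 0
  have hP : IsPeriodicLocal m r P := by
    intro x i j hc hw
    have e : perStrat m r (F x) x i = perStrat m r (F x) x j := by
      show F x (cls m i) (window r x i) = F x (cls m j) (window r x j)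
      rw [hc, hw]
    show ((if perStrat m r (F x) x i = true then (1 : ZMod 3) else 0) = 1) ↔
      ((if perStrat m r (F x) x j = true then (1 : ZMod 3) else 0) = 1)
    rw [e]
  obtain ⟨x, hodd, hwt, hrel⟩ := h₀ n hn h4 P hP
  apply hrel
  have e : (fun i => decide (P i x = 1)) = perStrat m r (F x) x := by
    funext i
    by_cases hb : perStrat m r (F x) x i = true
    · simp [P, hb]
    · simp [P, hb]
  rw [e]
  exact hF x hwt hodd

end Summit.QuantumAdvantage.QuantumAdvantage.Theorems.PeriodDial
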